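import Mathlib
import Literature.AlgebraicGeometry.Resolution.PointBlowupDirectrixGenericPoint
import Summits.ValiantsHypothesis.ValiantsHypothesis.Theorems.GrenetZeonTwoDimCoefficientsScalingClosure

/-!
# Crux `GrenetZeon.TwoDimCoefficients` (stmt-ValiantsHypothesis-8062), stub `stub_dualUnipotent`:
# scaling-closure engine, RANK FORM (lower semicontinuity of the Hessian rank along the curve)

Companion to `…TwoDimCoefficientsScalingClosure` (the curve-selection engine).  In the scaling-closure
argument the open side condition transported along the selected curve is "the rescaled Hessian has rank
`≥ 2m + 1`"; this file packages lower semicontinuity of matrix rank (a non-vanishing minor persists, via the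
tree's ✓ `rank_le_iff_forall_det_submatrix_eq_zero`) with the engine:

* `succ_le_rank_iff_exists_det_submatrix_ne_zero` — `k + 1 ≤ rank M ⟺` some `(k+1)`-minor `≠ 0`;
* `setOf_le_rank_mem_nhds` — for a continuous matrix-valued map `M` and `r ≤ rank (M a)`, the set
  `{x | r ≤ rank (M x)}` is a neighbourhood of `a`;
* `exists_off_coord_le_rank` — ENGINE, rank form: `F` strictly differentiable at `a`, `F'(e_j) ≠ 0`
  (`j ≠ i₀`), `M` continuous, `r ≤ rank (M a)` ⟹ `∃ x`, `x i₀ ≠ a i₀`, `F x = F a`, `r ≤ rank (M x)`;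
* ★ `exists_zero_off_coord_le_rank_mvPolynomial` — POLYNOMIAL FORM: `P ∈ ℂ[x_ι]` with `P(a) = 0`,
  `(∂_j P)(a) ≠ 0` (`j ≠ i₀`), `H` a matrix of polynomials with `r ≤ rank H(a)` ⟹ a zero `x` of `P` off
  the hyperplane `{x i₀ = a i₀}` with `r ≤ rank H(x)` — the exact shape consumed by the limit step
  (`P` = rescaled determinant family, `i₀` = the parameter `δ`, `H` = rescaled Hessian in `z`, `r = 2m + 1`).

HONEST FRAMING: an analytic/linear-algebra instrument; nothing about the permanent, the stub, the crux or
`VP ≠ VNP` is proved here.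

References: W. Bruns, U. Vetter, *Determinantal Rings*, LNM 1327 (1988), 1.C (rank loci are cut out by
minors; tree `rank_le_iff_forall_det_submatrix_eq_zero`); T. Mignon, N. Ressayre, Int. Math. Res. Not.
2004:79, Thm. 1.1.
-/

-- single-conjunct layout `Summits/ValiantsHypothesis/ValiantsHypothesis`: the duplicated namespace
-- component is mandated by the tree.
set_option linter.dupNamespace false
set_option autoImplicit false

noncomputable section

namespace Summit.ValiantsHypothesis.ValiantsHypothesis.Theorems.GrenetZeonTwoDimCoefficients.ScalingClosure

open Filter Topology

section Rank

variable {L : Type*} [Field L] {p q : Type*} [Fintype p] [Fintype q]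

/-- `k + 1 ≤ rank M` iff some `(k+1) × (k+1)` minor of `M` is non-zero (contrapositive of the tree's
✓ `rank_le_iff_forall_det_submatrix_eq_zero`). [cite: BrunsVetter1988, 1.C (p. 4)] -/
theorem succ_le_rank_iff_exists_det_submatrix_ne_zero (M : Matrix p q L) (k : ℕ) :
    k + 1 ≤ M.rank ↔ ∃ (ρ : Fin (k + 1) → p) (κ : Fin (k + 1) → q), (M.submatrix ρ κ).det ≠ 0 := by
  rw [Nat.succ_le_iff, ← not_le,
    Literature.AlgebraicGeometry.Resolution.PointBlowup.rank_le_iff_forall_det_submatrix_eq_zero]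
  push Not
  rfl

variable {X : Type*} [TopologicalSpace X] {𝕜 : Type*} [NontriviallyNormedField 𝕜]

/-- **Lower semicontinuity of rank.**  For a continuous matrix-valued map `M` and `r ≤ rank (M a)`, the
set `{x | r ≤ rank (M x)}` is a neighbourhood of `a` (the non-vanishing minor persists). [folklore] -/
theorem setOf_le_rank_mem_nhds (M : X → Matrix p q 𝕜) (hM : Continuous M) {a : X} {r : ℕ}
    (hr : r ≤ (M a).rank) : {x | r ≤ (M x).rank} ∈ 𝓝 a := by
  cases r with
  | zero => exact univ_mem' fun x => Nat.zero_le _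
  | succ k =>
    obtain ⟨ρ, κ, hdet⟩ := (succ_le_rank_iff_exists_det_submatrix_ne_zero (M a) k).mp hr
    have hcont : Continuous fun x => ((M x).submatrix ρ κ).det :=
      (hM.matrix_submatrix ρ κ).matrix_det
    have hopen : {x | ((M x).submatrix ρ κ).det ≠ 0} ∈ 𝓝 a :=
      hcont.continuousAt.preimage_mem_nhds (isOpen_ne.mem_nhds hdet)
    filter_upwards [hopen] with x hx
    exact (succ_le_rank_iff_exists_det_submatrix_ne_zero (M x) k).mpr ⟨ρ, κ, hx⟩

end Rank

section Engine

variable {𝕜 : Type*} [NontriviallyNormedField 𝕜] [CompleteSpace 𝕜] {ι : Type*} [Fintype ι]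
  [DecidableEq ι] {p q : Type*} [Fintype p] [Fintype q]

/-- **ENGINE, rank form.**  `F : 𝕜^ι → 𝕜` strictly differentiable at `a` with `F'(e_j) ≠ 0` for a
coordinate `j ≠ i₀`; `M` a continuous matrix-valued map with `r ≤ rank (M a)`.  Then there is `x` OFF the
hyperplane `{x i₀ = a i₀}` with `F x = F a` and `r ≤ rank (M x)`. [folklore] -/
theorem exists_off_coord_le_rank (F : (ι → 𝕜) → 𝕜) {F' : (ι → 𝕜) →L[𝕜] 𝕜} {a : ι → 𝕜}
    (hF : HasStrictFDerivAt F F' a) {i₀ j : ι} (hj : j ≠ i₀) (hFj : F' (Pi.single j 1) ≠ 0)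
    (M : (ι → 𝕜) → Matrix p q 𝕜) (hM : Continuous M) {r : ℕ} (hr : r ≤ (M a).rank) :
    ∃ x : ι → 𝕜, x i₀ ≠ a i₀ ∧ F x = F a ∧ r ≤ (M x).rank := by
  obtain ⟨x, hxS, hxi, hxF⟩ :=
    exists_mem_nhds_off_coord F hF hj hFj (setOf_le_rank_mem_nhds M hM hr)
  exact ⟨x, hxi, hxF, hxS⟩

end Engine

section Polynomial

open MvPolynomial

variable {ι : Type*} [Fintype ι] [DecidableEq ι] {p q : Type*} [Fintype p] [Fintype q]

omit [Fintype ι] [DecidableEq ι] [Fintype p] [Fintype q] in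
/-- Entrywise evaluation of a matrix of polynomials is continuous in the point. [folklore] -/
theorem continuous_matrix_map_eval (H : Matrix p q (MvPolynomial ι ℂ)) :
    Continuous fun x : ι → ℂ => H.map (eval x) :=
  continuous_pi fun i => continuous_pi fun j => continuous_eval (H i j)

/-- **Curve selection with a rank condition, polynomial form.**  `P ∈ ℂ[x_ι]`, `(∂_j P)(a) ≠ 0` for a
coordinate `j ≠ i₀`, `H` a matrix over `ℂ[x_ι]` with `r ≤ rank H(a)` ⟹ there is `x` with `x i₀ ≠ a i₀`,
`P(x) = P(a)` and `r ≤ rank H(x)`. [folklore] -/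
theorem exists_off_coord_le_rank_mvPolynomial (P : MvPolynomial ι ℂ) (H : Matrix p q (MvPolynomial ι ℂ))
    (a : ι → ℂ) {i₀ j : ι} (hj : j ≠ i₀) (hPj : eval a (pderiv j P) ≠ 0) {r : ℕ}
    (hr : r ≤ (H.map (eval a)).rank) :
    ∃ x : ι → ℂ, x i₀ ≠ a i₀ ∧ eval x P = eval a P ∧ r ≤ (H.map (eval x)).rank := by
  have hF : HasStrictFDerivAt (fun x : ι → ℂ => eval x P) (fderiv ℂ (fun x : ι → ℂ => eval x P) a) a :=
    ((AnalyticOnNhd.eval_mvPolynomial P) a (Set.mem_univ a)).hasStrictFDerivAt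
  have hFj : fderiv ℂ (fun x : ι → ℂ => eval x P) a (Pi.single j 1) ≠ 0 := by
    rwa [fderiv_eval_apply_single]
  exact exists_off_coord_le_rank (fun x => eval x P) hF hj hFj (fun x => H.map (eval x))
    (continuous_matrix_map_eval H) hr

/-- ★ **Zero-set form** (consumed by the limit step of the scaling-closure argument): if `P(a) = 0`,
`(∂_j P)(a) ≠ 0` for some `j ≠ i₀`, and `r ≤ rank H(a)`, then `P` has a zero `x` with `x i₀ ≠ a i₀` and
`r ≤ rank H(x)`. [folklore] -/
theorem exists_zero_off_coord_le_rank_mvPolynomial (P : MvPolynomial ι ℂ)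
    (H : Matrix p q (MvPolynomial ι ℂ)) (a : ι → ℂ) {i₀ j : ι} (hj : j ≠ i₀) (hPa : eval a P = 0)
    (hPj : eval a (pderiv j P) ≠ 0) {r : ℕ} (hr : r ≤ (H.map (eval a)).rank) :
    ∃ x : ι → ℂ, x i₀ ≠ a i₀ ∧ eval x P = 0 ∧ r ≤ (H.map (eval x)).rank := by
  obtain ⟨x, hxi, hxP, hxr⟩ := exists_off_coord_le_rank_mvPolynomial P H a hj hPj hr
  exact ⟨x, hxi, hxP.trans hPa, hxr⟩

end Polynomial

end Summit.ValiantsHypothesis.ValiantsHypothesis.Theorems.GrenetZeonTwoDimCoefficients.ScalingClosure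

end
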